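import Summits.BirchSwinnertonDyer.BirchSwinnertonDyer.Theses.KatoDescentTamePotSupersingular
import Summits.BirchSwinnertonDyer.BirchSwinnertonDyer.Theorems.KatoDescentTamePotSupersingularDefs
import Summits.BirchSwinnertonDyer.Rank1Residual.Additive.KatoDescentTorsionFree
import Summits.BirchSwinnertonDyer.Rank1Residual.Additive.PotSupersingularClasses
import Summits.BirchSwinnertonDyer.Rank1Residual.Supersingular.DescentLowerBound
import HarnessLib

/-!
# Route `KatoDescentTamePotSupersingular` (rung K8, sub-rung B4 (t′), cell `bsd-potss`): the crux
# `TameLowerHalfRankZero` (L₀, item stmt-BirchSwinnertonDyer-19981) ON THE ORDINARY-SHAPE CELL `L_{II*,5}`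
# by FOUQUET 2025's congruence transport from a good-ordinary partner (a `--supports … --as helper` file)

What is new relative to the cell's earlier roads to L₀ on (t′) (KMC glue p416912, Fouquet–Wan locus p417521
— PRE claim —, CM rows p418435, Kim / descent certificates p422109): here EVERY displayed input is a PUBLISHED
theorem. Memo of record: `HOME/k8t-c2/FINDING-19981-fouquet2025-k8t-c2-g3.md` (evidence on the item).

* Fouquet, Tunis. J. Math. 7 (2025) 791–829 (= arXiv:2501.07105), Thm 4.1 (1)⇒(2): Kato's main conjecture
  moves between motivic points of the local Hecke algebra `T^Σ_𝔪ρ̄` under Ass. 2.9/3.4, with NO hypothesis on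
  the reduction at `p` — shape `FouquetTransportShape KMC` (`…Defs`);
* on the (t′) cell `p = 5`, Kodaira II*, `v₅(c₄) = 4` (`SubLIIstarFive`) the local representation has
  ORDINARY shape (harvest-2 E94's canonical-subgroup character `ω^a`, `a = (e − w − m(p−1))/e ≡ 1 (mod 4)`;
  census: all 335 certified good-ordinary mod-5 partners of (t′) rows sit on this cell), so a good ORDINARY
  elliptic curve `G` with `G[5] ≅ W[5]` can be — and in the census is — a point of the same Hecke algebra;
* at such a `G` the tree's Skinner–Urban fact bsd.S21 (`skinner_urban_main_conjecture`, S–U 2014 Thm 3.6.9,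
  in `Λ` under `ρ_{G,5^∞}` onto) gives the Greenberg–Mazur main conjecture, which Kato §17.13 reads as
  Conj. 12.10 — shape `OrdinarySeedReadsKMC KMC`;
* §1 `KMC G 5`; §2 transport ⇒ `KMC W 5` ⇒ (the cell's image-free descent at a torsion-free member,
  `TorsionFree.missingPPartAt_rankZero_of_kmc`; `W[5]` irreducible ⇒ `W` is its own member) the `5`-part of
  BSD in Miller's currency and its lower half on the rank-`0` rows of `L_{II*,5}` with a partner;
* §3 the class form on the cell over a displayed partner oracle (in print the partner is the weight-2
  ordinary NEWFORM of level `N(ρ̄)` — Ribet/Edixhoven + S–U Thm 3.6.4 — for EVERY row of the cell; the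
  kernel's `KMC` interface types elliptic partners only).

Census (N < 5·10⁵, `TAME-L0-CENSUS-k8t-c2-g3.md`): the cell `L_{II*,5}` (II* at `5`, `v₅(c₄) = 4`, `ρ̄` onto,
ramified Steinberg prime, Ass. 3.4) has 429 rank-`0` (t′) rows, 85 with `25 ∣ #Ш_an` (content rows of the crux),
335 / 70 with a certified good-ordinary partner (e.g. `40200g1 ≡ 1608a1`, `50575q1 ≡ 2023b1 (mod 5)`).
CONDITIONAL throughout (`proof.conditional`: shapes + named facts as hypotheses); the item is NOT closed
(its class statement is an open problem off this cell); nothing is booked; BSD is not proved by any of this.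
Seat `bsd-potss-k8t-c2` (prover-bsd-potss-k8t-c2-g3-0), generation 3.

References: [Fouquet2025EquivariantTNC] Thm 4.1 (pp. 24–25), Thm 1.7 (p. 7), Ass. 2.9 (p. 15), Ass. 3.4 (pp. 22–23);
[SkinnerUrban2014] Thm 3.6.4 (p. 43), Thm 3.6.9 (p. 45); [Kato2004Asterisque] Conj. 12.10 (p. 224), Prop. 14.16 (2)
(p. 244), §17.13 (p. 280); [Miller2011LMS] Def. 1.1.
-/

set_option autoImplicit false
-- sibling precedent (`KatoDescentTamePotSupersingularAssembly.lean`): the directory name repeats the summit name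
set_option linter.dupNamespace false

noncomputable section

open scoped Classical

namespace Summit.BirchSwinnertonDyer.BirchSwinnertonDyer.Theorems

open WeierstrassCurve Literature.NumberTheory.EllipticCurves
  Literature.NumberTheory.EllipticCurves.ModularForms
  Literature.NumberTheory.EllipticCurves.Rank1Residual
  Literature.NumberTheory.EllipticCurves.Rank1Residual.Typed
  Summit.BirchSwinnertonDyer.Rank1Residual.Additive
  Summit.BirchSwinnertonDyer.Rank1Residual
  Summit.BirchSwinnertonDyer.BirchSwinnertonDyer.Theses.KatoDescentTamePotSupersingular

variable {IsOf : ∀ (W : WeierstrassCurve ℚ) [W.IsElliptic] [W.IsGloballyMinimal] (p : ℕ) [Fact p.Prime],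
  KatoDescentDatum p → Prop}
variable {KMC : ∀ (W : WeierstrassCurve ℚ) [W.IsElliptic] [W.IsGloballyMinimal] (p : ℕ), Prop}

/-! ## §1 The ordinary seed: Skinner–Urban (tree fact bsd.S21) read as `KMC` at the partner -/

/-- **KMC at a good ORDINARY partner from PUBLISHED inputs**: the tree's Skinner–Urban fact bsd.S21
(`skinner_urban_main_conjecture`, S–U 2014 Thm 3.6.9 = 3.6.4 + Kato 17.4; taken as the hypothesis `hSU`, no
`_holds` in the tree) delivers the Greenberg–Mazur main conjecture in `Λ` for `G` good ordinary at `p ≥ 5` with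
`G[p]` irreducible, a ramified Steinberg prime and `ρ_{G,p^∞}` onto; the §17.13 reading shape `hOrd`
(`OrdinarySeedReadsKMC`) turns it into Kato's Conj. 12.10 for `(G, p)`. Conditional on two displayed inputs, both
readings of PUBLISHED theorems; nothing credited.
[cite: SkinnerUrban2014, Thm. 3.6.9 (p. 45) and Thm. 3.6.4 (p. 43)] [cite: Kato2004Asterisque, §17.13 (p. 280)] -/
theorem kmc_of_goodOrd_of_skinnerUrban (hOrd : OrdinarySeedReadsKMC KMC)
    (hSU : ∀ (W : WeierstrassCurve ℚ) [W.IsElliptic] [W.IsGloballyMinimal] (p : ℕ) [Fact p.Prime]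
      (κ : ZpExtension ℚ p) (γ : Field.absoluteGaloisGroup ℚ) (N : ℕ) [NeZero N]
      (f : CuspForm (CongruenceSubgroup.Gamma0 N) 2),
      skinner_urban_main_conjecture W p (κ := κ) (γ := γ) (f := f))
    (G : WeierstrassCurve ℚ) [G.IsElliptic] [G.IsGloballyMinimal] (p : ℕ) [Fact p.Prime] (hp : 5 ≤ p)
    (hord : GoodOrd G p) (hirr : Irr G p) (hram : Ram G p)
    (htow : ∀ n : ℕ, G.HasSurjectiveModNGaloisRep (p ^ n : ℕ)) : KMC G p :=
  hOrd G p hp hord hirr hram htow (fun κ γ N _ f => hSU G p κ γ N f)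

/-! ## §2 Transport to the (t′) cell `L_{II*,5}` and the rank-0 `5`-part there -/

/-- **KMC₅ on the ordinary-shape (t′) cell from a good-ordinary partner** — the whole displayed road:
Fouquet 2025 Thm 4.1 (shape `hF`) moves `KMC` from the partner `G` (§1: Skinner–Urban + §17.13) to the
additive curve `W` with `W[5]` irreducible, `ρ̄_{W,5}` onto, `SubLIIstarFive W` (Kodaira II*, `v₅(c₄) = 4`:
ordinary local shape, Ass. 2.9 (2)), Ass. 3.4 on `LR(W)` (`FouquetEligibleAt 5 W`), along a level-compatible
mod-`5` congruence (`IsCongruentModP 5 W G`, `FouquetLevelCompatibleAt 5 W G`). Census (N < 5·10⁵): 335 such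
pairs of record with a certified congruence, e.g. `(W, G) = (40200g1, 1608a1)`, `(50575q1, 2023b1)`. Every
displayed input is a PUBLISHED theorem (readings); nothing credited.
[cite: Fouquet2025EquivariantTNC, Thm 4.1 (pp. 24–25)] [cite: SkinnerUrban2014, Thm. 3.6.9 (p. 45)] [cite: Kato2004Asterisque, §17.13 (p. 280)] -/
theorem kmc_five_of_subLIIstar_of_fouquet_of_goodOrdPartner (hF : FouquetTransportShape KMC)
    (hOrd : OrdinarySeedReadsKMC KMC)
    (hSU : ∀ (W : WeierstrassCurve ℚ) [W.IsElliptic] [W.IsGloballyMinimal] (p : ℕ) [Fact p.Prime]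
      (κ : ZpExtension ℚ p) (γ : Field.absoluteGaloisGroup ℚ) (N : ℕ) [NeZero N]
      (f : CuspForm (CongruenceSubgroup.Gamma0 N) 2),
      skinner_urban_main_conjecture W p (κ := κ) (γ := γ) (f := f))
    (W G : WeierstrassCurve ℚ) [W.IsElliptic] [W.IsGloballyMinimal] [G.IsElliptic] [G.IsGloballyMinimal]
    [Fact (5 : ℕ).Prime] (hX : ClassX4 W 5) (hsurj : Surj W 5) (hII : SubLIIstarFive W)
    (helig : FouquetEligibleAt 5 W) (hcong : IsCongruentModP 5 W G) (hlev : FouquetLevelCompatibleAt 5 W G)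
    (hord : GoodOrd G 5) (hirrG : Irr G 5) (hramG : Ram G 5)
    (htowG : ∀ n : ℕ, G.HasSurjectiveModNGaloisRep (5 ^ n : ℕ)) : KMC W 5 :=
  hF W G 5 le_rfl hX hsurj (Or.inr ⟨rfl, hII⟩) helig hcong hlev
    (kmc_of_goodOrd_of_skinnerUrban hOrd hSU G 5 le_rfl hord hirrG hramG htowG)

/-- **The `5`-part of BSD (both halves, Miller's currency) on the rank-0 rows of `L_{II*,5}` with a
good-ordinary partner, from PUBLISHED inputs only.** §2's `KMC W 5` + the cell's image-free descent at a
`5`-torsion-free member (`W[5]` irreducible ⇒ `W` is its own member: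
`tameMissingPPartAt_rankZero_of_irr_of_kmc`, readings 1♭/3♭ of Kato Prop. 14.16 (2) / Lemma T `hR`, `hreal`,
the interface lemma `hread`, GZK `hGZK`, modularity `hmod`). Displayed inputs: Fouquet Thm 4.1 (shape), Kato
§17.13 (shape), Skinner–Urban Thm 3.6.9 (tree fact bsd.S21), Kato's descent readings, GZK, modularity — all
published; the pair data are census-decidable. Conditional (`proof.conditional`); nothing credited, the item
stmt-BirchSwinnertonDyer-19981 is not closed (its class statement is open off this cell).
[cite: Fouquet2025EquivariantTNC, Thm 4.1 and Thm 1.7 (2)] [cite: Kato2004Asterisque, Conj. 12.10 (p. 224), Prop. 14.16 (2) (p. 244), §17.13 (p. 280)]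
[cite: SkinnerUrban2014, Thm. 3.6.9 (p. 45)] [cite: Miller2011LMS, Def. 1.1] -/
theorem tameMissingPPartAt_five_subLIIstar_of_fouquet_of_goodOrdPartner
    (hR : TorsionFree.DescentCountReading IsOf) (hreal : TorsionFree.RealizableOfKMC IsOf KMC)
    (hread : ReadsTrivialKMC IsOf KMC) (hGZK : rank_eq_analyticRank_of_analyticRank_le_one)
    (hmod : hasEntireLFunction_rat) (hF : FouquetTransportShape KMC) (hOrd : OrdinarySeedReadsKMC KMC)
    (hSU : ∀ (W : WeierstrassCurve ℚ) [W.IsElliptic] [W.IsGloballyMinimal] (p : ℕ) [Fact p.Prime]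
      (κ : ZpExtension ℚ p) (γ : Field.absoluteGaloisGroup ℚ) (N : ℕ) [NeZero N]
      (f : CuspForm (CongruenceSubgroup.Gamma0 N) 2),
      skinner_urban_main_conjecture W p (κ := κ) (γ := γ) (f := f))
    (W G : WeierstrassCurve ℚ) [W.IsElliptic] [W.IsGloballyMinimal] [G.IsElliptic] [G.IsGloballyMinimal]
    [Fact (5 : ℕ).Prime] (hr : W.analyticRank = 0) (hadd : Addv W 5) (hT : SubTprime W 5) (hirr : Irr W 5)
    (hsurj : Surj W 5) (hII : SubLIIstarFive W) (helig : FouquetEligibleAt 5 W)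
    (hcong : IsCongruentModP 5 W G) (hlev : FouquetLevelCompatibleAt 5 W G)
    (hord : GoodOrd G 5) (hirrG : Irr G 5) (hramG : Ram G 5)
    (htowG : ∀ n : ℕ, G.HasSurjectiveModNGaloisRep (5 ^ n : ℕ)) : MissingPPartAt W 5 :=
  have h52 : (5 : ℕ) ≠ 2 := by decide
  -- `W[5]` irreducible ⇒ `5 ∤ #W(ℚ)_tors`: `W` is its own torsion-free member; (t′) ⇒ potentially good
  have hO5 : ClassO5 W 5 := ⟨h52, hadd, Or.inr hT⟩
  TorsionFree.missingPPartAt_rankZero_of_kmc W 5 hR hreal hread hGZK hmod hr h52 hadd hO5.padicValRat_j_nonneg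
    (Supersingular.not_dvd_torsionOrder_of_irr W 5 hirr)
    (kmc_five_of_subLIIstar_of_fouquet_of_goodOrdPartner hF hOrd hSU W G ⟨h52, hadd, hirr⟩ hsurj hII helig
      hcong hlev hord hirrG hramG htowG)

/-- **L₀ on those rows** (the crux's currency `MissingLowerBoundAt W 5` — item 19981 restricted to the cell
`L_{II*,5}` with a good-ordinary partner): projection of §2's `MissingPPartAt`. Same displayed inputs; nothing
credited. [cite: Fouquet2025EquivariantTNC, Thm 4.1] [cite: Miller2011LMS, Def. 1.1] -/
theorem tameMissingLowerBoundAt_five_subLIIstar_of_fouquet_of_goodOrdPartner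
    (hR : TorsionFree.DescentCountReading IsOf) (hreal : TorsionFree.RealizableOfKMC IsOf KMC)
    (hread : ReadsTrivialKMC IsOf KMC) (hGZK : rank_eq_analyticRank_of_analyticRank_le_one)
    (hmod : hasEntireLFunction_rat) (hF : FouquetTransportShape KMC) (hOrd : OrdinarySeedReadsKMC KMC)
    (hSU : ∀ (W : WeierstrassCurve ℚ) [W.IsElliptic] [W.IsGloballyMinimal] (p : ℕ) [Fact p.Prime]
      (κ : ZpExtension ℚ p) (γ : Field.absoluteGaloisGroup ℚ) (N : ℕ) [NeZero N]
      (f : CuspForm (CongruenceSubgroup.Gamma0 N) 2),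
      skinner_urban_main_conjecture W p (κ := κ) (γ := γ) (f := f))
    (W G : WeierstrassCurve ℚ) [W.IsElliptic] [W.IsGloballyMinimal] [G.IsElliptic] [G.IsGloballyMinimal]
    [Fact (5 : ℕ).Prime] (hr : W.analyticRank = 0) (hadd : Addv W 5) (hT : SubTprime W 5) (hirr : Irr W 5)
    (hsurj : Surj W 5) (hII : SubLIIstarFive W) (helig : FouquetEligibleAt 5 W)
    (hcong : IsCongruentModP 5 W G) (hlev : FouquetLevelCompatibleAt 5 W G)
    (hord : GoodOrd G 5) (hirrG : Irr G 5) (hramG : Ram G 5)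
    (htowG : ∀ n : ℕ, G.HasSurjectiveModNGaloisRep (5 ^ n : ℕ)) : MissingLowerBoundAt W 5 :=
  (lower_and_upper_of_missingPPartAt W 5
    (tameMissingPPartAt_five_subLIIstar_of_fouquet_of_goodOrdPartner hR hreal hread hGZK hmod hF hOrd hSU
      W G hr hadd hT hirr hsurj hII helig hcong hlev hord hirrG hramG htowG)).1

/-! ## §3 The cell as a sub-case of the crux: `TameLowerHalfRankZero` restricted to `L_{II*,5}` -/

/-- **The crux's rows on the cell, class form over a partner oracle.** If every rank-0 (t′) row of the
cell `L_{II*,5}` (II* at `5`, `v₅(c₄) = 4`, `ρ̄` onto, Ass. 3.4) HAS a level-compatible good-ordinary partner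
with the Skinner–Urban hypotheses (`hpartner` — in print such a partner is supplied for EVERY such `W` by
level-lowering to the weight-2 ordinary newform of level `N(ρ̄)`, which need not be an elliptic curve; the
kernel's elliptic `KMC` interface types only elliptic partners, so the oracle is displayed), then L₀ holds on
the cell. With the published shapes/facts as in §2. Nothing credited.
[cite: Fouquet2025EquivariantTNC, Thm 4.1] [cite: SkinnerUrban2014, Thm. 3.6.4 (p. 43)] -/
theorem tameLowerHalf_five_subLIIstar_of_fouquet_of_partners
    (hR : TorsionFree.DescentCountReading IsOf) (hreal : TorsionFree.RealizableOfKMC IsOf KMC)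
    (hread : ReadsTrivialKMC IsOf KMC) (hGZK : rank_eq_analyticRank_of_analyticRank_le_one)
    (hmod : hasEntireLFunction_rat) (hF : FouquetTransportShape KMC) (hOrd : OrdinarySeedReadsKMC KMC)
    (hSU : ∀ (W : WeierstrassCurve ℚ) [W.IsElliptic] [W.IsGloballyMinimal] (p : ℕ) [Fact p.Prime]
      (κ : ZpExtension ℚ p) (γ : Field.absoluteGaloisGroup ℚ) (N : ℕ) [NeZero N]
      (f : CuspForm (CongruenceSubgroup.Gamma0 N) 2),
      skinner_urban_main_conjecture W p (κ := κ) (γ := γ) (f := f))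
    (hpartner : ∀ (W : WeierstrassCurve ℚ) [W.IsElliptic] [W.IsGloballyMinimal] [Fact (5 : ℕ).Prime],
      W.analyticRank = 0 → Addv W 5 → SubTprime W 5 → Irr W 5 → Surj W 5 → SubLIIstarFive W →
      FouquetEligibleAt 5 W →
        ∃ (G : WeierstrassCurve ℚ) (_ : G.IsElliptic) (_ : G.IsGloballyMinimal),
          IsCongruentModP 5 W G ∧ FouquetLevelCompatibleAt 5 W G ∧ GoodOrd G 5 ∧ Irr G 5 ∧ Ram G 5 ∧
            ∀ n : ℕ, G.HasSurjectiveModNGaloisRep (5 ^ n : ℕ)) :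
    ∀ (W : WeierstrassCurve ℚ) [W.IsElliptic] [W.IsGloballyMinimal] [Fact (5 : ℕ).Prime],
      W.analyticRank = 0 → Addv W 5 → SubTprime W 5 → Irr W 5 → Surj W 5 → SubLIIstarFive W →
      FouquetEligibleAt 5 W → MissingLowerBoundAt W 5 := by
  intro W _ _ _ hr hadd hT hirr hsurj hII helig
  obtain ⟨G, hGe, hGm, hcong, hlev, hord, hirrG, hramG, htowG⟩ := hpartner W hr hadd hT hirr hsurj hII helig
  exact tameMissingLowerBoundAt_five_subLIIstar_of_fouquet_of_goodOrdPartner hR hreal hread hGZK hmod hF hOrd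
    hSU W G hr hadd hT hirr hsurj hII helig hcong hlev hord hirrG hramG htowG

end Summit.BirchSwinnertonDyer.BirchSwinnertonDyer.Theorems

end
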